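import Summits.QuantumAdvantage.QuantumAdvantage.Theorems.ColumnBridgeB
import Summits.QuantumAdvantage.QuantumAdvantage.Theorems.LabelPreparationA
import Summits.QuantumAdvantage.QuantumAdvantage.Theorems.GlueFreeA
import Summits.QuantumAdvantage.QuantumAdvantage.Theorems.JointFreenessLawA

set_option linter.dupNamespace false
set_option linter.unusedSectionVars false

/-!
# ColumnBridgeC (lens 4, g29; the (c0) dispersing branch FROM KERNEL Y'S OUTPUT) — COMPOSITION

Blocker `X = AbsorptionDial.NoPerfectPolyOdd` (item 28487); decomp-qadv lens 4, g29.  `loss_of_freeDisperse_fromY` composes the label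
preparation (`LabelPreparationA.exists_prepared_basis` + `relabel`), the pool bookkeeping (`GlueFreeA.hfree_of_free_prepared`) and the prepared
column bridge (`ColumnBridgeB.loss_of_freeDisperse_prepared`): its hypotheses are stated over the ORIGINAL labels `Λ ∈ 𝔽_p^{k×n}` of register
`g₀` — a prepared set `U₀` (from `exists_puncture`), a cut `e`, a pool `T` enumerating a set `B` disjoint from `U₀`, kernel Y's FREE branch on
`B` (`hY`, with `t = 1`, `S = M + Mᵀ`, all label combinations `a′ ∈ 𝔽_p^k`), the threshold bookkeeping `w + |([n]∖U₀)∖B| ≤ w₀`, the dispersion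
count and the three numeric side conditions (with `k`, not the internal `k′ ≤ k`) — and its conclusion is a losing input.  So on the dispersing
branch NOTHING but parameter arithmetic stands between kernel Y (`JointFreenessLawA.free_dichotomy`, landed) and a loss.

* `exists_enum` (a pool enumerating a given finset), `comb_of_append_left` (an `Λf`-combination is a `Λ`-combination), `card_filter_le_corr`
  (off-`U₀` weight ≤ weight on `B` + `|([n]∖U₀)∖B|`), ★ `loss_of_freeDisperse_fromY`; `hY_of_Free` (kernel Y's `JointFreeness.Free` with `t = 1`,
  `S 0 = M + Mᵀ`, `I = range e` IS the hypothesis `hY`) and ★ `loss_of_Free` (the same theorem with `Free` verbatim).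

Supports stmt-QuantumAdvantage-28487 (record; the residual `X` is NOT claimed).
-/

open Finset
open Summit.QuantumAdvantage.AdviceFreeQNC0
open Summit.QuantumAdvantage.QuantumAdvantage.Theorems.InnerDegreeDial
open Summit.QuantumAdvantage.QuantumAdvantage.Theorems.BilinearCubeSum
open Summit.QuantumAdvantage.QuantumAdvantage.Theorems.LabelPreparation
open Summit.QuantumAdvantage.QuantumAdvantage.Theorems.GlueFree

namespace Summit.QuantumAdvantage.QuantumAdvantage.Theorems.ColumnBridge

variable {p : ℕ} [Fact p.Prime] {n m : ℕ}

/-- every finset of coordinates is enumerated by an embedding -/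
theorem exists_enum (B : Finset (Fin n)) : ∃ T : Fin B.card ↪ Fin n, ∀ l, l ∈ B ↔ ∃ i, T i = l := by
  refine ⟨(B.orderEmbOfFin rfl).toEmbedding, fun l => ⟨fun hl => ?_, ?_⟩⟩
  · have hl' : l ∈ Set.range (B.orderEmbOfFin rfl) := by
      rw [range_orderEmbOfFin]
      exact hl
    obtain ⟨i, hi⟩ := hl'
    exact ⟨i, hi⟩
  · rintro ⟨i, rfl⟩
    exact B.orderEmbOfFin_mem rfl i

/-- a combination of the rows `Λf = (GΛ)|_{first k′}` is a combination of the rows of `Λ` -/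
theorem comb_of_append_left {k k' k'' : ℕ} (Λ : Fin k → Fin n → ZMod p) (Λf : Fin k' → Fin n → ZMod p)
    (Λv : Fin k'' → Fin n → ZMod p) (G : Matrix (Fin (k' + k'')) (Fin k) (ZMod p))
    (hGΛ : (fun j i => ∑ l, G j l * Λ l i) = Fin.append Λf Λv) (a' : Fin k' → ZMod p) (l : Fin n) :
    (∑ q, a' q * Λf q l) = ∑ j, (∑ q, a' q * G (Fin.castAdd k'' q) j) * Λ j l := by
  have hrow : ∀ q, Λf q l = ∑ j, G (Fin.castAdd k'' q) j * Λ j l := by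
    intro q
    have h := congrFun (congrFun hGΛ (Fin.castAdd k'' q)) l
    rw [Fin.append_left] at h
    exact h.symm
  simp_rw [hrow, mul_sum, sum_mul]
  rw [sum_comm]
  refine sum_congr rfl fun j _ => sum_congr rfl fun q _ => ?_
  ring

/-- off-`U₀` weight is at most the weight on `B ⊆ [n] ∖ U₀` plus `|([n]∖U₀)∖B|` -/
theorem card_filter_le_corr (U₀ B : Finset (Fin n)) (f : Fin n → ZMod p) :
    (univ.filter fun i : Fin n => i ∉ U₀ ∧ f i ≠ 0).card
      ≤ (B.filter fun l => f l ≠ 0).card + (univ.filter fun i : Fin n => i ∉ U₀ ∧ i ∉ B).card := by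
  calc (univ.filter fun i : Fin n => i ∉ U₀ ∧ f i ≠ 0).card
      ≤ ((B.filter fun l => f l ≠ 0) ∪ (univ.filter fun i : Fin n => i ∉ U₀ ∧ i ∉ B)).card := by
        refine card_le_card fun i hi => ?_
        rw [mem_filter] at hi
        rw [mem_union, mem_filter, mem_filter]
        by_cases hiB : i ∈ B
        · exact Or.inl ⟨hiB, hi.2.2⟩
        · exact Or.inr ⟨mem_univ _, hi.2.1, hiB⟩
    _ ≤ _ := card_union_le _ _

/-- **THE DISPERSING BRANCH FROM KERNEL Y.**  Register `g₀` reads `H(Λ u, q(u))` (labels `Λ ∈ 𝔽_p^{k×n}`, one quadratic value), the other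
registers read `k` linear labels each.  Given: a set `U₀` prepared for `Λ` at threshold `w₀` (`exists_puncture`); a cut `e : Fin r ↪ [n]`; a
pool `T` enumerating a set `B` of `m` coordinates disjoint from `U₀` and from the cut; kernel Y's FREE conclusion on `B` at threshold `w`
(`hY`: every combination `Σ_i a_i (M+Mᵀ)_i + a′ᵀΛ` with `a ≠ 0` supported on the cut has `≥ w` non-zero coordinates in `B`); the bookkeeping
`w + |([n]∖U₀)∖B| ≤ w₀`; a side split of the pool whose cross block is `(w₂, E)`-dispersed; and the numeric side conditions `hsmall`,
`hcountA`, `hcountB` — some input LOSES. -/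
theorem loss_of_freeDisperse_fromY (hp5 : 5 ≤ p) (hp3 : p.Coprime 3) {k r : ℕ} (c : ℕ)
    (y : Fin (n + 1) → (Fin n → Bool) → Bool) (g₀ : Fin (n + 1))
    (lam : Fin (n + 1) → Fin k → Fin n → ZMod p) (F : Fin (n + 1) → (Fin k → ZMod p) → Bool)
    (hF : ∀ g, g ≠ g₀ → ∀ u, y g u = F g (fun j => ∑ i, if u i = true then lam g j i else 0))
    (Λ : Fin k → Fin n → ZMod p) (M : Fin n → Fin n → ZMod p) (b : Fin n → ZMod p)
    (H : (Fin k → ZMod p) → ZMod p → Bool)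
    (hy₀ : ∀ u, y g₀ u = H (fun j => ∑ i, if u i = true then Λ j i else 0) (quadVal M b u))
    (U₀ : Finset (Fin n)) (w₀ : ℕ) (hprep : Prepared Λ w₀ U₀)
    (e : Fin r ↪ Fin n) (T : Fin m ↪ Fin n) (heT : ∀ j i, e j ≠ T i) (B : Finset (Fin n))
    (hTB : ∀ l, l ∈ B ↔ ∃ i, T i = l) (hBU : ∀ l ∈ B, l ∉ U₀) (side : Fin m → Bool)
    (w : ℕ) (hw : w ≤ m) (hcorr : w + (univ.filter fun i : Fin n => i ∉ U₀ ∧ i ∉ B).card ≤ w₀)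
    (hY : ∀ (a : Fin n → ZMod p) (a' : Fin k → ZMod p), (∀ i, (∀ j, e j ≠ i) → a i = 0) → (∃ i, a i ≠ 0) →
      w ≤ (B.filter fun l => (∑ i, a i * (M i l + M l i)) + ∑ q, a' q * Λ q l ≠ 0).card)
    (w₂ E : ℕ)
    (hdisp : (univ.filter fun xx : (Side₁ side → Bool) × (Side₁ side → Bool) =>
      (univ.filter fun j => (rowForm (Cx M T side) xx.1 - rowForm (Cx M T side) xx.2) j ≠ 0).card < w₂).card ≤ E)
    (hsmall : 3 * (p : ℝ) ^ (r + k + 1) *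
      (Real.cos (Real.pi / (p * 3)) ^ w
        + Real.sqrt (E + 4 ^ Fintype.card (Side₁ side) * Real.cos (Real.pi / p) ^ w₂) / 2 ^ Fintype.card (Side₁ side)) < 1)
    (hcountA : (n + 1) * (p ^ k * 2) * (2 * p - 1) ^ m < (2 * p) ^ m)
    (hcountB : 3 * p ^ k * p ^ k * ((n + 1) * (p ^ k * 2) + 1) < 2 ^ r) :
    ∃ u, ringWinU c y u = false := by
  classical
  obtain ⟨k', k'', Λf, Λv, G, G', hk, hGG, hGΛ, hvan, hwt⟩ := exists_prepared_basis Λ w₀ U₀ hprep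
  subst hk
  have hy₀' : ∀ u, y g₀ u = (fun v z => H (G'.mulVec v) z)
      (fun j => ∑ i, if u i = true then Fin.append Λf Λv j i else 0) (quadVal M b u) := by
    intro u
    have h := relabel (y g₀) (quadVal M b) H Λ hy₀ G G' hGG u
    rw [← hGΛ]
    exact h
  have hp0 : 0 < p := by omega
  refine loss_of_freeDisperse_prepared hp5 hp3 c y g₀ lam F hF Λf Λv M b (fun v z => H (G'.mulVec v) z) hy₀' e T heT
    (fun j i => hvan j (T i) (hBU _ ((hTB _).mpr ⟨i, rfl⟩))) side w hw ?_ w₂ E hdisp ?_ hcountA ?_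
  · -- (d1) from kernel Y's free branch + the prepared labels
    intro γ hγ
    refine hfree_of_free_prepared M Λf e T B hTB w ?_ ?_ γ hγ
    · intro a a'f ha hane
      have h := hY a (fun j => ∑ q, a'f q * G (Fin.castAdd k'' q) j) ha hane
      have hcomb : ∀ l, (∑ q, a'f q * Λf q l) = ∑ j, (∑ q, a'f q * G (Fin.castAdd k'' q) j) * Λ j l :=
        fun l => comb_of_append_left Λ Λf Λv G hGΛ a'f l
      simp_rw [hcomb]
      exact h
    · intro a'f ha'
      have h1 := hwt a'f ha'
      have h2 := card_filter_le_corr U₀ B (fun i => ∑ q, a'f q * Λf q i)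
      omega
  · -- the exponent `r + k′ + 1 ≤ r + (k′ + k″) + 1`
    refine lt_of_le_of_lt ?_ hsmall
    have hX : 0 ≤ Real.cos (Real.pi / (p * 3)) ^ w
        + Real.sqrt (E + 4 ^ Fintype.card (Side₁ side) * Real.cos (Real.pi / p) ^ w₂) / 2 ^ Fintype.card (Side₁ side) := by
      have hc : 0 ≤ Real.cos (Real.pi / (p * 3)) := by
        apply Real.cos_nonneg_of_neg_pi_div_two_le_of_le
        · have : 0 ≤ Real.pi / (p * 3) := by positivity
          linarith [Real.pi_pos]
        · have h2 : (2 : ℝ) ≤ p * 3 := by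
            have : (5 : ℝ) ≤ p := by exact_mod_cast hp5
            linarith
          exact div_le_div_of_nonneg_left Real.pi_pos.le (by norm_num) h2
      positivity
    have hpow : (p : ℝ) ^ (r + k' + 1) ≤ (p : ℝ) ^ (r + (k' + k'') + 1) :=
      pow_le_pow_right₀ (by exact_mod_cast hp0) (by omega)
    nlinarith
  · refine lt_of_le_of_lt ?_ hcountB
    have h1 : p ^ k' ≤ p ^ (k' + k'') := Nat.pow_le_pow_right hp0 (by omega)
    have h2 : 3 * p ^ (k' + k'') * p ^ k' ≤ 3 * p ^ (k' + k'') * p ^ (k' + k'') := Nat.mul_le_mul_left _ h1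
    exact Nat.mul_le_mul_right _ h2

/-- kernel Y's `Free` (one pencil `S 0 = M + Mᵀ`, cut `I = range e`) is the hypothesis `hY` of `loss_of_freeDisperse_fromY` -/
theorem hY_of_Free {k r : ℕ} (M : Fin n → Fin n → ZMod p) (Λ : Fin k → Fin n → ZMod p) (B : Finset (Fin n)) (w : ℕ)
    (e : Fin r ↪ Fin n)
    (hFree : JointFreeness.Free (fun (_ : Fin 1) i l => M i l + M l i) Λ B w (univ.map e))
    (a : Fin n → ZMod p) (a' : Fin k → ZMod p) (ha : ∀ i, (∀ j, e j ≠ i) → a i = 0) (hane : ∃ i, a i ≠ 0) :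
    w ≤ (B.filter fun l => (∑ i, a i * (M i l + M l i)) + ∑ q, a' q * Λ q l ≠ 0).card := by
  classical
  obtain ⟨i₀, hi₀⟩ := hane
  have hsupp : JointFreeness.SuppIn (univ.map e) (fun (_ : Fin 1) => a) := by
    intro _ i hi
    refine ha i fun j hj => hi ?_
    rw [mem_map]
    exact ⟨j, mem_univ _, hj⟩
  have h := hFree (fun _ => a) a' hsupp ⟨0, i₀, hi₀⟩
  unfold JointFreeness.wtOn JointFreeness.comb at h
  simp only [Fin.sum_univ_one] at h
  convert h using 2

/-- **THE DISPERSING BRANCH FROM KERNEL Y, verbatim.**  `loss_of_freeDisperse_fromY` with kernel Y's `JointFreeness.Free (M+Mᵀ) Λ B w (range e)`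
in place of `hY`. -/
theorem loss_of_Free (hp5 : 5 ≤ p) (hp3 : p.Coprime 3) {k r : ℕ} (c : ℕ)
    (y : Fin (n + 1) → (Fin n → Bool) → Bool) (g₀ : Fin (n + 1))
    (lam : Fin (n + 1) → Fin k → Fin n → ZMod p) (F : Fin (n + 1) → (Fin k → ZMod p) → Bool)
    (hF : ∀ g, g ≠ g₀ → ∀ u, y g u = F g (fun j => ∑ i, if u i = true then lam g j i else 0))
    (Λ : Fin k → Fin n → ZMod p) (M : Fin n → Fin n → ZMod p) (b : Fin n → ZMod p)
    (H : (Fin k → ZMod p) → ZMod p → Bool)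
    (hy₀ : ∀ u, y g₀ u = H (fun j => ∑ i, if u i = true then Λ j i else 0) (quadVal M b u))
    (U₀ : Finset (Fin n)) (w₀ : ℕ) (hprep : Prepared Λ w₀ U₀)
    (e : Fin r ↪ Fin n) (T : Fin m ↪ Fin n) (heT : ∀ j i, e j ≠ T i) (B : Finset (Fin n))
    (hTB : ∀ l, l ∈ B ↔ ∃ i, T i = l) (hBU : ∀ l ∈ B, l ∉ U₀) (side : Fin m → Bool)
    (w : ℕ) (hw : w ≤ m) (hcorr : w + (univ.filter fun i : Fin n => i ∉ U₀ ∧ i ∉ B).card ≤ w₀)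
    (hFree : JointFreeness.Free (fun (_ : Fin 1) i l => M i l + M l i) Λ B w (univ.map e))
    (w₂ E : ℕ)
    (hdisp : (univ.filter fun xx : (Side₁ side → Bool) × (Side₁ side → Bool) =>
      (univ.filter fun j => (rowForm (Cx M T side) xx.1 - rowForm (Cx M T side) xx.2) j ≠ 0).card < w₂).card ≤ E)
    (hsmall : 3 * (p : ℝ) ^ (r + k + 1) *
      (Real.cos (Real.pi / (p * 3)) ^ w
        + Real.sqrt (E + 4 ^ Fintype.card (Side₁ side) * Real.cos (Real.pi / p) ^ w₂) / 2 ^ Fintype.card (Side₁ side)) < 1)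
    (hcountA : (n + 1) * (p ^ k * 2) * (2 * p - 1) ^ m < (2 * p) ^ m)
    (hcountB : 3 * p ^ k * p ^ k * ((n + 1) * (p ^ k * 2) + 1) < 2 ^ r) :
    ∃ u, ringWinU c y u = false :=
  loss_of_freeDisperse_fromY hp5 hp3 c y g₀ lam F hF Λ M b H hy₀ U₀ w₀ hprep e T heT B hTB hBU side w hw hcorr
    (hY_of_Free M Λ B w e hFree) w₂ E hdisp hsmall hcountA hcountB

end Summit.QuantumAdvantage.QuantumAdvantage.Theorems.ColumnBridge
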